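import Mathlib
import HarnessLib
import Literature.NumberTheory.Transcendental.Associators
import Literature.NumberTheory.Transcendental.AssociatorsPentagonWeightTwo

/-!
# `KernelModuloPeriodConjecture`, line `Sketch`: the algebraic leaf holds in weight `≤ 4`

Crux `FurushoPentagon.KernelModuloPeriodConjecture` (stmt-KontsevichZagierPeriods-15058), line
`Sketch`, registered stub `stub_associatorHoffmanSpanning` (the ALGEBRAIC LEAF, = the planner's
prepared child crux `AssociatorHoffmanSpanning`): for every admissible index `s` one rational
combination `b` of Hoffman indices of the same weight with
`c_{binaryWord s}(φ) = Σ_t b_t c_{binaryWord t}(φ)` at every group-like solution `φ` of Drinfeld's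
pentagon over every reduced commutative `ℚ`-algebra. In all weights this is the coordinate form of
`GRT₁ ≅ U^{dR}_{MT(ℤ)}` (open). This helper file is the line's CONSISTENCY CERTIFICATE for the typed
leaf: it holds, unconditionally and without reducedness, for every admissible index of weight `≤ 4`
(`associatorHoffmanSpanning_of_weight_le_four`), from the tree's weight-`≤ 4` content of the
pentagon for group-like series: `c_{X₀} = c_{X₁} = 0`
(`DrinfeldPentagon.apply_letter_eq_zero_of_isGroupLike`), `c_{X₀X₀X₁} + c_{X₀X₁X₁} = 0`
(`DrinfeldPentagon.apply_weight_three`, i.e. `ζ(2,1) = ζ(3)` for associators) and the four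
weight-4 identities (`DrinfeldPentagon.apply_weight_four'`, i.e. `ζ(4) = (4/3) ζ(2,2)`,
`ζ(3,1) = (1/3) ζ(2,2)`, `ζ(2,1,1) = (4/3) ζ(2,2)` for associators, in the sign convention
`c_W = (−1)^{dp W} ζ(W)`). The eight admissible indices of weight `≤ 4` are
`∅, (2), (3), (2,1), (4), (3,1), (2,2), (2,1,1)`; the Hoffman ones reduce to themselves.
(Worked out by the line's stub worker; no statement of the crux or of the leaf is weakened here —
the leaf itself stays registered and open.)

References: V. Drinfeld, Leningrad Math. J. 2 (1991) [Drinfeld1991]; H. Furusho, *Pentagon and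
hexagon equations*, Ann. of Math. 171 (2010) [Furusho2010]; D. Bar-Natan, *On associators and the
Grothendieck–Teichmüller group*, Selecta Math. 4 (1998) [BarNatan1998].
-/

noncomputable section

namespace Summit.KontsevichZagierPeriods.FurushoPentagon.KernelModuloPeriodConjecture

open Literature.NumberTheory.Transcendental

/-- `Σ` over a single-point `Finsupp`: `(single t q).sum (t ↦ q ↦ q • c_t) = q • c_t`. [folklore] -/
theorem leafLowWeight_sum_single {R : Type} [CommRing R] [Algebra ℚ R] (φ : NCSeries Bool R)
    (t : List ℕ) (q : ℚ) :
    (Finsupp.single t q).sum (fun t q => q • φ (MZV.binaryWord t)) = q • φ (MZV.binaryWord t) := by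
  rw [Finsupp.sum_single_index]
  exact zero_smul _ _

/-- The support of `single t q` is contained in `{t}`. [folklore] -/
theorem leafLowWeight_eq_of_mem_support_single {t : List ℕ} {q : ℚ} {u : List ℕ}
    (hu : u ∈ (Finsupp.single t q).support) : u = t := by
  classical
  exact Finset.mem_singleton.mp (Finsupp.support_single_subset hu)

/-- **A Hoffman index reduces to itself** (`b = single s 1`). [folklore] -/
theorem leafLowWeight_of_isHoffman {s : List ℕ} (hs : MZV.IsHoffman s) :
    ∃ b : List ℕ →₀ ℚ, (∀ t ∈ b.support, MZV.IsHoffman t ∧ MZV.weight t = MZV.weight s) ∧ ∀ (R : Type) [CommRing R] [Algebra ℚ R] [IsReduced R] (φ : NCSeries Bool R), NCSeries.IsGroupLike φ → NCSeries.DrinfeldPentagon φ → φ (MZV.binaryWord s) = b.sum (fun t q => q • φ (MZV.binaryWord t)) := by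
  refine ⟨Finsupp.single s 1, fun t ht => ?_, fun R _ _ _ φ _ _ => ?_⟩
  · rw [leafLowWeight_eq_of_mem_support_single ht]; exact ⟨hs, rfl⟩
  · rw [leafLowWeight_sum_single, one_smul]

/-- Division by a non-zero rational scalar in a `ℚ`-algebra: `n · x = m · y`, `n ≠ 0` gives
`x = (m/n) • y`. [folklore] -/
theorem leafLowWeight_eq_smul_of_mul_eq {R : Type} [CommRing R] [Algebra ℚ R] {n m : ℚ}
    (hn : n ≠ 0) {x y : R} (h : algebraMap ℚ R n * x = algebraMap ℚ R m * y) :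
    x = (m / n) • y := by
  have hu : IsUnit (algebraMap ℚ R n) := (IsUnit.mk0 n hn).map _
  refine hu.mul_left_cancel ?_
  rw [h, Algebra.smul_def, ← mul_assoc, ← map_mul, mul_div_cancel₀ m hn]

/-- **The algebraic leaf holds for every admissible index of weight `≤ 4`**, for every group-like
pentagon solution over every commutative `ℚ`-algebra (reducedness is not used): `∅, (2), (3), (2,2)`
are Hoffman; `(2,1) ↦ −c_{(3)}` (`apply_weight_three`); `(4) ↦ −(4/3) c_{(2,2)}`,
`(3,1) ↦ (1/3) c_{(2,2)}`, `(2,1,1) ↦ −(4/3) c_{(2,2)}` (`apply_weight_four'`).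
[cite: Furusho2010, §3; BarNatan1998, §4] -/
theorem associatorHoffmanSpanning_of_weight_le_four {s : List ℕ} (hs : MZV.IsAdmissible s)
    (hw : MZV.weight s ≤ 4) :
    ∃ b : List ℕ →₀ ℚ, (∀ t ∈ b.support, MZV.IsHoffman t ∧ MZV.weight t = MZV.weight s) ∧ ∀ (R : Type) [CommRing R] [Algebra ℚ R] [IsReduced R] (φ : NCSeries Bool R), NCSeries.IsGroupLike φ → NCSeries.DrinfeldPentagon φ → φ (MZV.binaryWord s) = b.sum (fun t q => q • φ (MZV.binaryWord t)) := by
  obtain ⟨hpos, hhead⟩ := hs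
  match s, hpos, hhead, hw with
  | [], _, _, _ => exact leafLowWeight_of_isHoffman (by decide)
  | [a], _, hhead, hw =>
    have ha : 2 ≤ a := hhead (by simp)
    have ha' : a ≤ 4 := by simpa [MZV.weight] using hw
    interval_cases a
    · exact leafLowWeight_of_isHoffman (by decide)
    · exact leafLowWeight_of_isHoffman (by decide)
    · -- `s = (4)`: `3 c_{X₀³X₁} = −4 c_{X₀X₁X₀X₁}`
      refine ⟨Finsupp.single [2, 2] (-20 / 15), fun t ht => ?_, fun R _ _ _ φ hg h5 => ?_⟩
      · rw [leafLowWeight_eq_of_mem_support_single ht]; exact ⟨by decide, rfl⟩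
      · rw [leafLowWeight_sum_single]
        have hx := h5.apply_letter_eq_zero_of_isGroupLike hg false
        have hy := h5.apply_letter_eq_zero_of_isGroupLike hg true
        obtain ⟨e1, e2, e3, e4⟩ := h5.apply_weight_four' hg.apply_nil hx hy
        show φ [false, false, false, true] = (-20 / 15 : ℚ) • φ [false, true, false, true]
        refine leafLowWeight_eq_smul_of_mul_eq (by norm_num) ?_
        rw [map_neg, map_ofNat, map_ofNat]
        linear_combination 3 * e1 + 2 * e3
  | [a, b], hpos, hhead, hw =>
    have ha : 2 ≤ a := hhead (by simp)
    have hb : 1 ≤ b := hpos b (by simp)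
    have hw' : a + b ≤ 4 := by simpa [MZV.weight] using hw
    have ha' : a ≤ 3 := by omega
    have hb' : b ≤ 2 := by omega
    interval_cases a <;> interval_cases b
    · -- `s = (2,1)`: `c_{X₀X₁X₁} = −c_{X₀X₀X₁}`
      refine ⟨Finsupp.single [3] (-1), fun t ht => ?_, fun R _ _ _ φ hg h5 => ?_⟩
      · rw [leafLowWeight_eq_of_mem_support_single ht]; exact ⟨by decide, rfl⟩
      · rw [leafLowWeight_sum_single]
        have hx := h5.apply_letter_eq_zero_of_isGroupLike hg false
        have hy := h5.apply_letter_eq_zero_of_isGroupLike hg true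
        have h3 := h5.apply_weight_three hg.apply_nil hx hy
        show φ [false, true, true] = (-1 : ℚ) • φ [false, false, true]
        rw [neg_smul, one_smul]
        linear_combination h3
    · exact leafLowWeight_of_isHoffman (by decide)
    · -- `s = (3,1)`: `3 c_{X₀X₀X₁X₁} = c_{X₀X₁X₀X₁}`
      refine ⟨Finsupp.single [2, 2] (10 / 30), fun t ht => ?_, fun R _ _ _ φ hg h5 => ?_⟩
      · rw [leafLowWeight_eq_of_mem_support_single ht]; exact ⟨by decide, rfl⟩
      · rw [leafLowWeight_sum_single]
        have hx := h5.apply_letter_eq_zero_of_isGroupLike hg false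
        have hy := h5.apply_letter_eq_zero_of_isGroupLike hg true
        obtain ⟨e1, e2, e3, e4⟩ := h5.apply_weight_four' hg.apply_nil hx hy
        show φ [false, false, true, true] = (10 / 30 : ℚ) • φ [false, true, false, true]
        refine leafLowWeight_eq_smul_of_mul_eq (by norm_num) ?_
        rw [map_ofNat, map_ofNat]
        linear_combination 3 * e2 - e3
    · omega
  | [a, b, c], hpos, hhead, hw =>
    have ha : 2 ≤ a := hhead (by simp)
    have hb : 1 ≤ b := hpos b (by simp)
    have hc : 1 ≤ c := hpos c (by simp)
    have hw' : a + (b + c) ≤ 4 := by simpa [MZV.weight] using hw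
    obtain rfl : a = 2 := by omega
    obtain rfl : b = 1 := by omega
    obtain rfl : c = 1 := by omega
    -- `s = (2,1,1)`: `3 c_{X₀X₁³} = −4 c_{X₀X₁X₀X₁}`
    refine ⟨Finsupp.single [2, 2] (-20 / 15), fun t ht => ?_, fun R _ _ _ φ hg h5 => ?_⟩
    · rw [leafLowWeight_eq_of_mem_support_single ht]; exact ⟨by decide, rfl⟩
    · rw [leafLowWeight_sum_single]
      have hx := h5.apply_letter_eq_zero_of_isGroupLike hg false
      have hy := h5.apply_letter_eq_zero_of_isGroupLike hg true
      obtain ⟨e1, e2, e3, e4⟩ := h5.apply_weight_four' hg.apply_nil hx hy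
      show φ [false, true, true, true] = (-20 / 15 : ℚ) • φ [false, true, false, true]
      refine leafLowWeight_eq_smul_of_mul_eq (by norm_num) ?_
      rw [map_neg, map_ofNat, map_ofNat]
      linear_combination 3 * e4 + 2 * e3
  | a :: b :: c :: d :: u, hpos, hhead, hw =>
    exfalso
    have ha : 2 ≤ a := hhead (by simp)
    have hb : 1 ≤ b := hpos b (by simp)
    have hc : 1 ≤ c := hpos c (by simp)
    have hd : 1 ≤ d := hpos d (by simp)
    have hw' : a + (b + (c + (d + u.sum))) ≤ 4 := by simpa [MZV.weight] using hw
    omega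

/-- **Registered sub-goal `stub_leafLowWeight`** (the weight-`≤ 4` slice of the algebraic leaf, in
`Prop` form): for every admissible index of weight `≤ 4` the Hoffman reduction holds at every
group-like pentagon solution over every reduced commutative `ℚ`-algebra.
[cite: Furusho2010, §3; BarNatan1998, §4] -/
theorem stub_leafLowWeight :
    ∀ s : List ℕ, MZV.IsAdmissible s → MZV.weight s ≤ 4 → ∃ b : List ℕ →₀ ℚ, (∀ t ∈ b.support, MZV.IsHoffman t ∧ MZV.weight t = MZV.weight s) ∧ ∀ (R : Type) [CommRing R] [Algebra ℚ R] [IsReduced R] (φ : NCSeries Bool R), NCSeries.IsGroupLike φ → NCSeries.DrinfeldPentagon φ → φ (MZV.binaryWord s) = b.sum (fun t q => q • φ (MZV.binaryWord t)) :=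
  fun _ hs hw => associatorHoffmanSpanning_of_weight_le_four hs hw

end Summit.KontsevichZagierPeriods.FurushoPentagon.KernelModuloPeriodConjecture

end
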